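import Summits.QuantumFields.YangMills.Theorems.BalabanUVNodesN21GappedPairRoadRStepNeutral
import Summits.QuantumFields.YangMills.Theorems.BalabanUVNodesN20OffLiveOneTermReadingCmap

/-!
# N20 (NE7b) — THE PAIR ROAD COSTS N20 NOTHING, χ-GENERIC («Cmap»): at the doubly-gapped χ-carriers `gapWeight2A∕B₁₃Chi θ χ … ρ ρ′ n₁ n₂` the bad-class sums and the totals
# are DIAL-FREE, width zero gives the χ-record's OWN carriers `weightA∕B₁₃Chi`, hence `RelWeightBound` at the doubly-gapped χ-carriers ⟺ at the χ-record's carriers; at the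
# K3ᴬ v8 mirror: v8's N20 conjunct at ANY below-top cut reading from `RelWeightBound` witnesses at the RE-CENTRED RECORD's OWN carriers — N20's row no longer reads N21's dials

Cell `pub-ymgap` (HUMAN RULING D-0062, Track A), seat `pub-ymgap-dag-n20-d` (gen 47; R134 (a) N20 s3; op-5c-class K3ᴬ supply, `--kind proof --supports stmt-QuantumFields-27247 --as helper`;
count-neutral; proves NO registered stub).  N20's OWN column (N20-invariance on the pair road) RE-KEYED over the β-slot: §1–§3 are the χ-generic twins of dag-n21-d's V5a
`…N21GappedPairRoadN20Invariance` §53 and V6 `…N21GappedPairRoadRStepNeutral` §56 — `(hP : θ.Provisos₁₃CoPH F N) ↦ (χ : ChiSlot F N) (hP : θ.Provisos₁₃CoPHChi F N χ)`,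
`histA∕B₁₃ ↦ histA∕B₁₃Chi θ χ`, `keyA∕B₁₃ ↦ keyA∕B₁₃Chi θ χ`, `classSet₁₃ ∕ weightA∕B₁₃ ∕ badClass₁₃ ↦ …Chi θ χ` (this lineage's T3 `…SpineReadingOfRecord13CoPHChi` ✓p806069),
`gapWeight2A∕B₁₃ ↦ gapWeight2A∕B₁₃Chi θ χ` (dag-n15-a's `…N21GappedTopPairReading13CoPHDefsCmap`), `datumOfRecord₁₃CoPH ↦ datumOfRecord₁₃CoPHChi θ χ hP` — with PROOFS THROUGH THE
PARENTS' DATUM-GENERIC LEMMAS BY NAME (V5a §52 `sum_filter_topTerm2AtLevel_letter_free`, V6 §55 `classWeightOfDatum₉_eq_topTerm2AtLevel_eps_twoDelta_of_ppSelLive`, dag-n21-d §6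
`integrable_chi_mul_dressedSlots_of_ppSelLive`); nothing of V5a ∕ V6 is restated at `CoPH`.  (H-ζ) is the provisos' ROW `zetaMeas` (v1.8), so NO hypothesis beyond the live-selector
pin enters.  [LF-I] = [Balaban1989LargeFieldI], [LF-II] = [Balaban1989LargeFieldII], [III] = [Balaban1988Convergent].

CONTENTS.  §1 (any χ) `keyA∕B₁₃Chi_mem_classSet₁₃Chi` · `keyB₁₃Chi_fst` · `keyA∕B₁₃Chi_mem_badClass₁₃Chi_iff(_exists)` · ★ `keyA∕B₁₃Chi_mem_badClass₁₃Chi_determined` (policy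
`jcut K < K₀ + K ∨ jcut K = 0`: bad membership is decided BELOW THE TOP).  §2 (live line `hsel`, (H-ζ) from the provisos) `sum_keys_gapWeight2A∕B₁₃Chi_eq_sum_filter` · ★★
`sum_keys_gapWeight2A∕B₁₃Chi_letter_free` · ★★ `sum_badClass₁₃Chi_gapWeight2_letter_free` · `sum_classSet₁₃Chi_gapWeight2_letter_free` · ★★★ `relWeightBound_gap2Carriers_iff_chi`.
§3 ★★ `weightA∕B₁₃Chi_eq_gapWeight2A∕B₁₃Chi_widthZero` (the χ-record's class weight IS the width-zero doubly-gapped weight, every key, every depth pair) · ★★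
`relWeightBound_record_iff_gap2Carriers_widthZero_chi` · ★★★ `relWeightBound_gap2Carriers_iff_record_chi` (every `W`, every dial, every below-top policy).  §4 AT THE K3ᴬ v8 MIRROR
(`N = 2`, `χ := chiβOfRecord₁₃Ax`, offset `0`): ★★★ `keyedRelWeight_of_liveGap2Pin_of_recordWitness` — `PinnedAtLiveGap2 jc ρ ρ′ n₁ n₂ cr` (ANY cut reading with `jc … K < K ∨
jc … K = 0`) + the off-live pin to `crOneTerm₁₃Ax 0` (✓p813406) + `RelWeightBound` witnesses AT THE RE-CENTRED RECORD's OWN CARRIERS `weightA∕B₁₃Ax θ 0 g₀ os hP` with bad class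
`badClass₁₃Ax θ 0 g₀ (jc …)` on the guarded admissible tuples of the live line ⟹ `KeyedRelWeight cr`: THE N20 ROW OF `stub_expansion13HV` AT A NONZERO CUT IS DIAL-FREE — the
conclusion shape of this lineage's road-[e] priced face (✓p791592 `forSmallCouplings_relWeightBound_chronoGenealogies_ofRecord_undressedAE_of_liveSel`, CoPH-keyed; its χ ∕ Ax
re-keying is NOT in this file) read at the re-centred record.

HONEST FRAMING.  [folklore] Fubini ∕ fibre-sum ∕ case-split bookkeeping BY NAME; NO estimate of Bałaban's; N20's face itself is NOT proved (only its dial-freeness and its reading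
at the record's own carriers); E1 and the (RT) ∕ weight-neutrality identities are the parents' partition-of-unity bookkeeping ([LF-I] (0.3)–(0.4), [III] (3.16)), not bounds;
NE7b ∕ NE7c ∕ NE7 NOT PRINTED for `d = 4`; no `Provisos₁₃CoPHChi ∕ …Ax` inhabitant claimed (K0ᴬ OPEN); NO stub of K3ᴬ v8 is closed or claimed (0∕2); N20 ∕ N21 NOT discharged;
counts UNMOVED (typed 28∕28 · discharged 8∕27 · A 8∕28 · K 1∕4); never a count claim.  One finite `𝕋⁴_{L^K}` programme at fixed `ε = L^{−K}`, Bałaban AS PRINTED — NOT ℝ⁴, NOT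
infinite volume, NOT OS, NOT a mass gap; the YM mass gap (Clay) is NOT proved by any of this.  No `def`, no `instance`, no `notation`, no `sorry`, standard axioms.
Sources (locators, bookkeeping only): [LF-I] (0.3)–(0.4) p.176, p.181 «we change the regularity conditions by a factor»; [LF-II] Thm 1 + (0.1) pp.355–356, (1.79) p.383,
(1.80) p.384, (1.89) p.387; [III] (2.18) p.257, (3.16) p.268; [King1986] (3.10)–(3.11) p.656.
-/

set_option autoImplicit false

noncomputable section

open scoped BigOperators
open Finset MeasureTheory

namespace Summit.QuantumFields.YangMills.BalabanUVNodes.N20InvarianceAtGap2ReadingCmap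

open Literature.MathematicalPhysics.QuantumFieldTheory.Balaban1983to89
open Literature.MathematicalPhysics.QuantumFieldTheory.Balaban1983to89.T4Continuum
open Literature.MathematicalPhysics.QuantumFieldTheory.Balaban1983to89.Node00
open B14.Eq218Concrete
open T4WeightBudget (RelWeightBound)
open YMDAG.UVSplit (runA₁₃ runB₁₃ histA₁₃Chi histB₁₃Chi histA₁₃Chi_zero histB₁₃Chi_zero keyA₁₃Chi keyB₁₃Chi keyB₁₃Chi_eq classSet₁₃Chi weightA₁₃Chi weightB₁₃Chi badClass₁₃Chi
  classSet₁₃Ax weightA₁₃Ax weightB₁₃Ax badClass₁₃Ax SpineReading₁₃CoPHAx)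
open Summit.QuantumFields.BalabanUV.T4Continuum.Spine
open Summit.QuantumFields.YangMills.BalabanUVNodes.SpineCanonicalWeights
open Summit.QuantumFields.YangMills.Theorems.N21StepWeightsPositivity (zetaOfRecord_nonneg)
open Summit.QuantumFields.YangMills.Theorems.N21ShellSplitOfRecord13CoPH
open Summit.QuantumFields.YangMills.Theorems.N21GappedTopPair13CoPH (topTerm2AtLevel bCutGrid selDepthA2₁₃Chi selDepthB2₁₃Chi gapWeight2A₁₃Chi gapWeight2B₁₃Chi
  crGap2₁₃VAtCmap crGap2₁₃VAx)
open Summit.QuantumFields.YangMills.Theorems.K3AxV8Defs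
open Summit.QuantumFields.YangMills.BalabanUVNodes.N20KeyedRelWeightAtGap2ReadingCmap (relWeightBound_crGap2₁₃VAtCmap)
open Summit.QuantumFields.YangMills.BalabanUVNodes.N20OffLiveOneTermReadingCmap (crOneTerm₁₃Ax keyedRelWeight_of_livePin)

variable {F : T4Family} {N : ℕ} [NeZero N]

/-! ## §1 Keys over the β-slot `χ`: class membership, bad membership, bad membership decided below the top -/

section Keys

variable (θ : Stage13HParams F N) (χ : ChiSlot F N) (K₀ : ℕ) (g₀ : ℕ → ℝ) (jcut : ℕ → ℕ)

/-- Run A's χ-key of record lies in the χ-class set of record. [bookkeeping] -/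
theorem keyA₁₃Chi_mem_classSet₁₃Chi (K : ℕ) (s : SeqOfRecord F θ.ν θ.τ9.M (histA₁₃Chi θ χ K₀ g₀ K) (K₀ + K) (K₀ + K)) :
    keyA₁₃Chi θ χ K₀ g₀ K s ∈ classSet₁₃Chi θ χ K₀ g₀ K := by
  letI : ∀ Kc, DecidableEq (SiteSeqKey F Kc) := fun _ => Classical.decEq _
  unfold classSet₁₃Chi
  exact Finset.mem_union_left _ (Finset.mem_image_of_mem _ (Finset.mem_univ s))

/-- Run B's χ-key of record lies in the χ-class set of record. [bookkeeping] -/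
theorem keyB₁₃Chi_mem_classSet₁₃Chi (K : ℕ) (s' : SeqOfRecord F θ.ν θ.τ9.M (histB₁₃Chi θ χ K₀ g₀ K) (K₀ + K + 1) (K₀ + K + 1)) :
    keyB₁₃Chi θ χ K₀ g₀ K s' ∈ classSet₁₃Chi θ χ K₀ g₀ K := by
  letI : ∀ Kc, DecidableEq (SiteSeqKey F Kc) := fun _ => Classical.decEq _
  unfold classSet₁₃Chi
  exact Finset.mem_union_right _ (Finset.mem_image_of_mem _ (Finset.mem_univ s'))

/-- Run B's χ-key sits over its own comparison index (both branches of the total key). [bookkeeping] -/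
theorem keyB₁₃Chi_fst (K : ℕ) (s' : SeqOfRecord F θ.ν θ.τ9.M (histB₁₃Chi θ χ K₀ g₀ K) (K₀ + K + 1) (K₀ + K + 1)) : (keyB₁₃Chi θ χ K₀ g₀ K s').1 = K := by
  unfold keyB₁₃Chi
  split_ifs <;> rfl

/-- **«RUN A's χ-KEY IS BAD» ⟺ AN OLD LARGE-FIELD REGION AT A LEVEL `≤ jcut K` ON THE KEY** (`badKeysSigma` membership + §1). [cite: Balaban1989LargeFieldII, (1.80) p.384 (bookkeeping)] -/
theorem keyA₁₃Chi_mem_badClass₁₃Chi_iff (K : ℕ) (t : ℝ) (s : SeqOfRecord F θ.ν θ.τ9.M (histA₁₃Chi θ χ K₀ g₀ K) (K₀ + K) (K₀ + K)) :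
    keyA₁₃Chi θ χ K₀ g₀ K s ∈ badClass₁₃Chi θ χ K₀ g₀ jcut K t ↔ KeyOldLargeField (jcut K) (keyA₁₃Chi θ χ K₀ g₀ K s).2 := by
  unfold badClass₁₃Chi
  rw [mem_badKeysSigma_iff]
  exact ⟨fun h => h.2, fun h => ⟨keyA₁₃Chi_mem_classSet₁₃Chi θ χ K₀ g₀ K s, h⟩⟩

/-- **«RUN B's χ-KEY IS BAD» ⟺ AN OLD LARGE-FIELD REGION AT A LEVEL `≤ jcut K` ON THE BLOCK-DOWN KEY**. [cite: Balaban1989LargeFieldII, (1.80) p.384 (bookkeeping)] -/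
theorem keyB₁₃Chi_mem_badClass₁₃Chi_iff (K : ℕ) (t : ℝ) (s' : SeqOfRecord F θ.ν θ.τ9.M (histB₁₃Chi θ χ K₀ g₀ K) (K₀ + K + 1) (K₀ + K + 1)) :
    keyB₁₃Chi θ χ K₀ g₀ K s' ∈ badClass₁₃Chi θ χ K₀ g₀ jcut K t ↔ KeyOldLargeField (jcut K) (keyB₁₃Chi θ χ K₀ g₀ K s').2 := by
  unfold badClass₁₃Chi
  rw [mem_badKeysSigma_iff, show jcut (keyB₁₃Chi θ χ K₀ g₀ K s').1 = jcut K by rw [keyB₁₃Chi_fst]]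
  exact ⟨fun h => h.2, fun h => ⟨keyB₁₃Chi_mem_classSet₁₃Chi θ χ K₀ g₀ K s', h⟩⟩

/-- **RUN A: BAD MEMBERSHIP READS THE LEVELS `≤ jcut K`** — the χ-key of `s` is in the persistence class iff `Λ_j(s) ≠ 𝕋` for some `1 ≤ j ≤ jcut K` (§1 + node U5d's
`keyOldLargeField_twoRunKeyA_iff`). [cite: Balaban1989LargeFieldII, (1.80) p.384; Balaban1988Convergent, (2.18) p.257 (bookkeeping)] -/
theorem keyA₁₃Chi_mem_badClass₁₃Chi_iff_exists (K : ℕ) (t : ℝ) (s : SeqOfRecord F θ.ν θ.τ9.M (histA₁₃Chi θ χ K₀ g₀ K) (K₀ + K) (K₀ + K)) :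
    keyA₁₃Chi θ χ K₀ g₀ K s ∈ badClass₁₃Chi θ χ K₀ g₀ jcut K t ↔ ∃ j, 1 ≤ j ∧ j ≤ jcut K ∧ s.Λ j ≠ Set.univ :=
  (keyA₁₃Chi_mem_badClass₁₃Chi_iff θ χ K₀ g₀ jcut K t s).trans (keyOldLargeField_twoRunKeyA_iff F θ.ν θ.τ9.M _ _ _ (jcut K) s)

/-- **RUN B: BAD MEMBERSHIP READS THE LEVELS `≤ jcut K + 1`** (`0 < M`, `jcut K ≤ K₀ + K`) — through `keyB₁₃Chi_eq` + node U5d's `keyOldLargeField_twoRunKeyB_iff`.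
[cite: Balaban1989LargeFieldII, (1.80) p.384; Balaban1988Convergent, (2.18) p.257 (bookkeeping)] -/
theorem keyB₁₃Chi_mem_badClass₁₃Chi_iff_exists (hM : 0 < θ.τ9.M) (K : ℕ) (t : ℝ) (hj : jcut K ≤ K₀ + K)
    (s' : SeqOfRecord F θ.ν θ.τ9.M (histB₁₃Chi θ χ K₀ g₀ K) (K₀ + K + 1) (K₀ + K + 1)) :
    keyB₁₃Chi θ χ K₀ g₀ K s' ∈ badClass₁₃Chi θ χ K₀ g₀ jcut K t ↔ ∃ j, 1 ≤ j ∧ j ≤ jcut K ∧ blockDownSet F (K₀ + K) (s'.Λ (j + 1)) ≠ Set.univ := by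
  rw [keyB₁₃Chi_mem_badClass₁₃Chi_iff θ χ K₀ g₀ jcut K t s', keyB₁₃Chi_eq θ χ K₀ g₀ hM K s']
  exact keyOldLargeField_twoRunKeyB_iff F θ.ν hM _ _ _ hj s'

/-- ★ **RUN A: for a policy cutting STRICTLY BELOW THE TOP (`jcut K < K₀ + K`; or not cutting at all, `jcut K = 0`), bad membership of `keyA₁₃Chi … s` is DECIDED BELOW THE TOP.**
[cite: Balaban1989LargeFieldII, (1.80) p.384 (bookkeeping)] -/
theorem keyA₁₃Chi_mem_badClass₁₃Chi_determined (K : ℕ) (t : ℝ) (hj : jcut K < K₀ + K ∨ jcut K = 0)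
    (s₁ s₂ : SeqOfRecord F θ.ν θ.τ9.M (histA₁₃Chi θ χ K₀ g₀ K) (K₀ + K) (K₀ + K))
    (h : ∀ i, 1 ≤ i → i < K₀ + K → s₁.Λ i = s₂.Λ i ∧ s₁.Ω i = s₂.Ω i) :
    keyA₁₃Chi θ χ K₀ g₀ K s₁ ∈ badClass₁₃Chi θ χ K₀ g₀ jcut K t ↔ keyA₁₃Chi θ χ K₀ g₀ K s₂ ∈ badClass₁₃Chi θ χ K₀ g₀ jcut K t := by
  rw [keyA₁₃Chi_mem_badClass₁₃Chi_iff_exists, keyA₁₃Chi_mem_badClass₁₃Chi_iff_exists]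
  refine exists_congr fun j => ⟨fun ⟨h1, h2, h3⟩ => ⟨h1, h2, ?_⟩, fun ⟨h1, h2, h3⟩ => ⟨h1, h2, ?_⟩⟩
  · have hjK : j < K₀ + K := by rcases hj with hj | hj <;> omega
    rwa [← (h j h1 hjK).1]
  · have hjK : j < K₀ + K := by rcases hj with hj | hj <;> omega
    rwa [(h j h1 hjK).1]

/-- ★ **RUN B: for `jcut K < K₀ + K` (or `jcut K = 0`), bad membership of `keyB₁₃Chi … s′` is DECIDED BELOW RUN B's TOP `K₀ + K + 1`** — at `M = 0` the key is the constant junk key.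
[cite: Balaban1989LargeFieldII, (1.80) p.384 (bookkeeping)] -/
theorem keyB₁₃Chi_mem_badClass₁₃Chi_determined (K : ℕ) (t : ℝ) (hj : jcut K < K₀ + K ∨ jcut K = 0)
    (s₁ s₂ : SeqOfRecord F θ.ν θ.τ9.M (histB₁₃Chi θ χ K₀ g₀ K) (K₀ + K + 1) (K₀ + K + 1))
    (h : ∀ i, 1 ≤ i → i < K₀ + K + 1 → s₁.Λ i = s₂.Λ i ∧ s₁.Ω i = s₂.Ω i) :
    keyB₁₃Chi θ χ K₀ g₀ K s₁ ∈ badClass₁₃Chi θ χ K₀ g₀ jcut K t ↔ keyB₁₃Chi θ χ K₀ g₀ K s₂ ∈ badClass₁₃Chi θ χ K₀ g₀ jcut K t := by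
  by_cases hM : 0 < θ.τ9.M
  · have hj' : jcut K ≤ K₀ + K := by rcases hj with hj | hj <;> omega
    rw [keyB₁₃Chi_mem_badClass₁₃Chi_iff_exists θ χ K₀ g₀ jcut hM K t hj', keyB₁₃Chi_mem_badClass₁₃Chi_iff_exists θ χ K₀ g₀ jcut hM K t hj']
    refine exists_congr fun j => ⟨fun ⟨h1, h2, h3⟩ => ⟨h1, h2, ?_⟩, fun ⟨h1, h2, h3⟩ => ⟨h1, h2, ?_⟩⟩
    · have hjK : j + 1 < K₀ + K + 1 := by rcases hj with hj | hj <;> omega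
      rwa [← (h (j + 1) (by omega) hjK).1]
    · have hjK : j + 1 < K₀ + K + 1 := by rcases hj with hj | hj <;> omega
      rwa [(h (j + 1) (by omega) hjK).1]
  · have hc : keyB₁₃Chi θ χ K₀ g₀ K s₁ = keyB₁₃Chi θ χ K₀ g₀ K s₂ := by simp [keyB₁₃Chi, hM]
    rw [hc]

end Keys

/-! ## §2 On the live line: the bad-class sums and the totals of the doubly-gapped χ-weights are DIAL-FREE; `RelWeightBound` too -/

section LetterFree

variable (θ : Stage13HParams F N) (χ : ChiSlot F N) (hP : θ.Provisos₁₃CoPHChi F N χ) (K₀ : ℕ) (g₀ : ℕ → ℝ) (os : List (ULoop F)) (jcut : ℕ → ℕ)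

/-- run A: the sum of the doubly-gapped χ-weights over ANY finite key set is the sum of the pair-lettered top terms of the χ-datum over the histories keyed into it (fibre sums
along `keyA₁₃Chi`; the filter read with the reading's own classical key decidability). [bookkeeping] -/
theorem sum_keys_gapWeight2A₁₃Chi_eq_sum_filter (K : ℕ) (S : Finset (Σ K, SiteSeqKey F (K₀ + K))) (ρ ρ' : ℕ → ℝ) (n₁ n₂ : ℕ → ℕ) (t : ℝ) :
    ∑ x ∈ S, gapWeight2A₁₃Chi θ χ hP K₀ g₀ os ρ ρ' n₁ n₂ K t x =
      letI : ∀ Kc, DecidableEq (SiteSeqKey F Kc) := fun _ => Classical.decEq _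
      ∑ s ∈ univ.filter (fun s => keyA₁₃Chi θ χ K₀ g₀ K s ∈ S),
        topTerm2AtLevel F N θ.toStage9Params (datumOfRecord₁₃CoPHChi F N θ χ hP) g₀ os (runA₁₃ F K₀ g₀ K) (histA₁₃Chi θ χ K₀ g₀ K)
          (cutGrid θ.ν (histA₁₃Chi θ χ K₀ g₀ K) (K₀ + K) (ρ K) (selDepthA2₁₃Chi θ χ hP K₀ g₀ os ρ (n₁ K) K t + 1))
          (bCutGrid θ.ν θ.A₁ (histA₁₃Chi θ χ K₀ g₀ K) (K₀ + K - 1) (ρ' K) (selDepthB2₁₃Chi θ χ hP K₀ g₀ os ρ' (n₂ K) K t + 1)) t (K₀ + K) s := by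
  letI : ∀ Kc, DecidableEq (SiteSeqKey F Kc) := fun _ => Classical.decEq _
  unfold gapWeight2A₁₃Chi
  have hmaps : ∀ s ∈ univ.filter (fun s => keyA₁₃Chi θ χ K₀ g₀ K s ∈ S), keyA₁₃Chi θ χ K₀ g₀ K s ∈ S := fun s hs => (Finset.mem_filter.1 hs).2
  rw [← Finset.sum_fiberwise_of_maps_to hmaps]
  refine Finset.sum_congr rfl fun x hx => Finset.sum_congr ?_ fun _ _ => rfl
  ext s
  simp only [Finset.mem_filter, Finset.mem_univ, true_and]
  exact ⟨fun h => ⟨h ▸ hx, h⟩, fun h => h.2⟩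

/-- run B: the same along `keyB₁₃Chi`. [bookkeeping] -/
theorem sum_keys_gapWeight2B₁₃Chi_eq_sum_filter (K : ℕ) (S : Finset (Σ K, SiteSeqKey F (K₀ + K))) (ρ ρ' : ℕ → ℝ) (n₁ n₂ : ℕ → ℕ) (t : ℝ) :
    ∑ x ∈ S, gapWeight2B₁₃Chi θ χ hP K₀ g₀ os ρ ρ' n₁ n₂ K t x =
      letI : ∀ Kc, DecidableEq (SiteSeqKey F Kc) := fun _ => Classical.decEq _
      ∑ s' ∈ univ.filter (fun s' => keyB₁₃Chi θ χ K₀ g₀ K s' ∈ S),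
        topTerm2AtLevel F N θ.toStage9Params (datumOfRecord₁₃CoPHChi F N θ χ hP) g₀ os (runB₁₃ F K₀ g₀ K) (histB₁₃Chi θ χ K₀ g₀ K)
          (cutGrid θ.ν (histB₁₃Chi θ χ K₀ g₀ K) (K₀ + K + 1) (ρ K) (selDepthA2₁₃Chi θ χ hP K₀ g₀ os ρ (n₁ K) K t + 1))
          (bCutGrid θ.ν θ.A₁ (histB₁₃Chi θ χ K₀ g₀ K) (K₀ + K) (ρ' K) (selDepthB2₁₃Chi θ χ hP K₀ g₀ os ρ' (n₂ K) K t + 1)) t (K₀ + K + 1) s' := by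
  letI : ∀ Kc, DecidableEq (SiteSeqKey F Kc) := fun _ => Classical.decEq _
  unfold gapWeight2B₁₃Chi
  have hmaps : ∀ s' ∈ univ.filter (fun s' => keyB₁₃Chi θ χ K₀ g₀ K s' ∈ S), keyB₁₃Chi θ χ K₀ g₀ K s' ∈ S := fun s' hs' => (Finset.mem_filter.1 hs').2
  rw [← Finset.sum_fiberwise_of_maps_to hmaps]
  refine Finset.sum_congr rfl fun x hx => Finset.sum_congr ?_ fun _ _ => rfl
  ext s'
  simp only [Finset.mem_filter, Finset.mem_univ, true_and]
  exact ⟨fun h => ⟨h ▸ hx, h⟩, fun h => h.2⟩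

variable (E : B12.RunParams → ℝ) (hsel : θ.ppSel = ppSelLiveOfRecord F N θ.ν θ.τ9 E (wOfRecord₉ F N θ.toStage9Params))
include hsel

/-- ★★ **THE SUM OF RUN A's DOUBLY-GAPPED χ-WEIGHTS OVER A KEY SET DECIDED BELOW THE TOP DOES NOT DEPEND ON THE DIALS** (live line; (H-ζ), `Σ|ζ| ≤ 1`, unity from the provisos):
whenever membership `keyA₁₃Chi … s ∈ S` is decided below the top, `Σ_{x ∈ S} gapWeight2A₁₃Chi … ρ ρ′ n₁ n₂ K t x` is the same for every `(ρ, ρ′, n₁, n₂)` — V5a §52 at the χ-datum.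
[cite: Balaban1989LargeFieldI, (0.3)–(0.4) p.176, p.181; Balaban1988Convergent, (3.16) p.268 (bookkeeping)] -/
theorem sum_keys_gapWeight2A₁₃Chi_letter_free (K : ℕ) (S : Finset (Σ K, SiteSeqKey F (K₀ + K)))
    (hS : 0 < K₀ + K → ∀ s₁ s₂ : SeqOfRecord F θ.ν θ.τ9.M (histA₁₃Chi θ χ K₀ g₀ K) (K₀ + K) (K₀ + K),
      (∀ i, 1 ≤ i → i < K₀ + K → s₁.Λ i = s₂.Λ i ∧ s₁.Ω i = s₂.Ω i) → (keyA₁₃Chi θ χ K₀ g₀ K s₁ ∈ S ↔ keyA₁₃Chi θ χ K₀ g₀ K s₂ ∈ S))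
    (ρ ρ' : ℕ → ℝ) (n₁ n₂ : ℕ → ℕ) (σ σ' : ℕ → ℝ) (m₁ m₂ : ℕ → ℕ) (t : ℝ) :
    ∑ x ∈ S, gapWeight2A₁₃Chi θ χ hP K₀ g₀ os ρ ρ' n₁ n₂ K t x = ∑ x ∈ S, gapWeight2A₁₃Chi θ χ hP K₀ g₀ os σ σ' m₁ m₂ K t x := by
  letI : ∀ Kc, DecidableEq (SiteSeqKey F Kc) := fun _ => Classical.decEq _
  have hζ0 : ∀ p g k s Pl Ql RS U V', 0 ≤ θ.ζ p g k s Pl Ql RS U V' :=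
    fun p g k s Pl Ql RS U V' => zetaOfRecord_nonneg F N θ.ν θ.τ9.M hP.zetaUnity hP.zetaAbs p g k s Pl Ql RS U V'
  have hU : LocalBgMeasurable F N θ.ν := localBgMeasurable F N θ.ν
  have hD : (datumOfRecord₁₃CoPHChi F N θ χ hP).AvgMeasurable := (isPrintedAveraged_datumOfRecord₁₃CoPH_chi F N θ χ hP).avgMeasurable
  rw [sum_keys_gapWeight2A₁₃Chi_eq_sum_filter, sum_keys_gapWeight2A₁₃Chi_eq_sum_filter]
  exact sum_filter_topTerm2AtLevel_letter_free F N θ.toStage9Params (datumOfRecord₁₃CoPHChi F N θ χ hP) g₀ os (runA₁₃ F K₀ g₀ K) (histA₁₃Chi θ χ K₀ g₀ K)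
    hP.zetaMeas hP.zetaAbs hP.zetaUnity t
    (fun k _ s => integrable_chi_mul_dressedSlots_of_ppSelLive θ.toStage9Params E hsel hU hP.zetaMeas hζ0 hP.zetaAbs _ hD g₀ os (histA₁₃Chi_zero θ χ K₀ g₀ K) t k s)
    (K₀ + K) rfl (fun s => keyA₁₃Chi θ χ K₀ g₀ K s ∈ S) hS _ _ _ _

/-- ★★ **… AND RUN B's** (membership decided below run B's top `K₀ + K + 1`). [cite: Balaban1989LargeFieldI, (0.3)–(0.4) p.176, p.181; Balaban1988Convergent, (3.16) p.268 (bookkeeping)] -/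
theorem sum_keys_gapWeight2B₁₃Chi_letter_free (K : ℕ) (S : Finset (Σ K, SiteSeqKey F (K₀ + K)))
    (hS : ∀ s₁ s₂ : SeqOfRecord F θ.ν θ.τ9.M (histB₁₃Chi θ χ K₀ g₀ K) (K₀ + K + 1) (K₀ + K + 1),
      (∀ i, 1 ≤ i → i < K₀ + K + 1 → s₁.Λ i = s₂.Λ i ∧ s₁.Ω i = s₂.Ω i) → (keyB₁₃Chi θ χ K₀ g₀ K s₁ ∈ S ↔ keyB₁₃Chi θ χ K₀ g₀ K s₂ ∈ S))
    (ρ ρ' : ℕ → ℝ) (n₁ n₂ : ℕ → ℕ) (σ σ' : ℕ → ℝ) (m₁ m₂ : ℕ → ℕ) (t : ℝ) :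
    ∑ x ∈ S, gapWeight2B₁₃Chi θ χ hP K₀ g₀ os ρ ρ' n₁ n₂ K t x = ∑ x ∈ S, gapWeight2B₁₃Chi θ χ hP K₀ g₀ os σ σ' m₁ m₂ K t x := by
  letI : ∀ Kc, DecidableEq (SiteSeqKey F Kc) := fun _ => Classical.decEq _
  have hζ0 : ∀ p g k s Pl Ql RS U V', 0 ≤ θ.ζ p g k s Pl Ql RS U V' :=
    fun p g k s Pl Ql RS U V' => zetaOfRecord_nonneg F N θ.ν θ.τ9.M hP.zetaUnity hP.zetaAbs p g k s Pl Ql RS U V'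
  have hU : LocalBgMeasurable F N θ.ν := localBgMeasurable F N θ.ν
  have hD : (datumOfRecord₁₃CoPHChi F N θ χ hP).AvgMeasurable := (isPrintedAveraged_datumOfRecord₁₃CoPH_chi F N θ χ hP).avgMeasurable
  rw [sum_keys_gapWeight2B₁₃Chi_eq_sum_filter, sum_keys_gapWeight2B₁₃Chi_eq_sum_filter]
  exact sum_filter_topTerm2AtLevel_letter_free F N θ.toStage9Params (datumOfRecord₁₃CoPHChi F N θ χ hP) g₀ os (runB₁₃ F K₀ g₀ K) (histB₁₃Chi θ χ K₀ g₀ K)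
    hP.zetaMeas hP.zetaAbs hP.zetaUnity t
    (fun k _ s => integrable_chi_mul_dressedSlots_of_ppSelLive θ.toStage9Params E hsel hU hP.zetaMeas hζ0 hP.zetaAbs _ hD g₀ os (histB₁₃Chi_zero θ χ K₀ g₀ K) t k s)
    (K₀ + K + 1) rfl (fun s' => keyB₁₃Chi θ χ K₀ g₀ K s' ∈ S) (fun _ => hS) _ _ _ _

/-- ★★ **THE BAD-CLASS SUMS OF THE DOUBLY-GAPPED χ-WEIGHTS ARE DIAL-FREE** (policy `jcut K < K₀ + K ∨ jcut K = 0`; live line) — both runs.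
[cite: Balaban1989LargeFieldII, (1.80) p.384; Balaban1989LargeFieldI, p.181 (bookkeeping)] -/
theorem sum_badClass₁₃Chi_gapWeight2_letter_free (K : ℕ) (hj : jcut K < K₀ + K ∨ jcut K = 0) (ρ ρ' : ℕ → ℝ) (n₁ n₂ : ℕ → ℕ) (σ σ' : ℕ → ℝ) (m₁ m₂ : ℕ → ℕ) (t : ℝ) :
    ∑ x ∈ badClass₁₃Chi θ χ K₀ g₀ jcut K t, gapWeight2A₁₃Chi θ χ hP K₀ g₀ os ρ ρ' n₁ n₂ K t x =
        ∑ x ∈ badClass₁₃Chi θ χ K₀ g₀ jcut K t, gapWeight2A₁₃Chi θ χ hP K₀ g₀ os σ σ' m₁ m₂ K t x ∧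
      ∑ x ∈ badClass₁₃Chi θ χ K₀ g₀ jcut K t, gapWeight2B₁₃Chi θ χ hP K₀ g₀ os ρ ρ' n₁ n₂ K t x =
        ∑ x ∈ badClass₁₃Chi θ χ K₀ g₀ jcut K t, gapWeight2B₁₃Chi θ χ hP K₀ g₀ os σ σ' m₁ m₂ K t x :=
  ⟨sum_keys_gapWeight2A₁₃Chi_letter_free θ χ hP K₀ g₀ os E hsel K _
      (fun _ s₁ s₂ h => keyA₁₃Chi_mem_badClass₁₃Chi_determined θ χ K₀ g₀ jcut K t hj s₁ s₂ h) _ _ _ _ _ _ _ _ t,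
    sum_keys_gapWeight2B₁₃Chi_letter_free θ χ hP K₀ g₀ os E hsel K _
      (fun s₁ s₂ h => keyB₁₃Chi_mem_badClass₁₃Chi_determined θ χ K₀ g₀ jcut K t hj s₁ s₂ h) _ _ _ _ _ _ _ _ t⟩

/-- ★ **THE TOTALS OF THE DOUBLY-GAPPED χ-WEIGHTS ARE DIAL-FREE** (every key is a class) — both runs. [cite: Balaban1989LargeFieldI, (0.3)–(0.4) p.176, p.181 (bookkeeping)] -/
theorem sum_classSet₁₃Chi_gapWeight2_letter_free (K : ℕ) (ρ ρ' : ℕ → ℝ) (n₁ n₂ : ℕ → ℕ) (σ σ' : ℕ → ℝ) (m₁ m₂ : ℕ → ℕ) (t : ℝ) :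
    ∑ x ∈ classSet₁₃Chi θ χ K₀ g₀ K, gapWeight2A₁₃Chi θ χ hP K₀ g₀ os ρ ρ' n₁ n₂ K t x = ∑ x ∈ classSet₁₃Chi θ χ K₀ g₀ K, gapWeight2A₁₃Chi θ χ hP K₀ g₀ os σ σ' m₁ m₂ K t x ∧
      ∑ x ∈ classSet₁₃Chi θ χ K₀ g₀ K, gapWeight2B₁₃Chi θ χ hP K₀ g₀ os ρ ρ' n₁ n₂ K t x =
        ∑ x ∈ classSet₁₃Chi θ χ K₀ g₀ K, gapWeight2B₁₃Chi θ χ hP K₀ g₀ os σ σ' m₁ m₂ K t x :=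
  ⟨sum_keys_gapWeight2A₁₃Chi_letter_free θ χ hP K₀ g₀ os E hsel K _
      (fun _ s₁ s₂ _ => ⟨fun _ => keyA₁₃Chi_mem_classSet₁₃Chi θ χ K₀ g₀ K s₂, fun _ => keyA₁₃Chi_mem_classSet₁₃Chi θ χ K₀ g₀ K s₁⟩) _ _ _ _ _ _ _ _ t,
    sum_keys_gapWeight2B₁₃Chi_letter_free θ χ hP K₀ g₀ os E hsel K _
      (fun s₁ s₂ _ => ⟨fun _ => keyB₁₃Chi_mem_classSet₁₃Chi θ χ K₀ g₀ K s₂, fun _ => keyB₁₃Chi_mem_classSet₁₃Chi θ χ K₀ g₀ K s₁⟩) _ _ _ _ _ _ _ _ t⟩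

/-- ★★★ **`RelWeightBound` AT THE DOUBLY-GAPPED χ-CARRIERS IS ONE STATEMENT FOR ALL DIALS** (policies with `jcut K < K₀ + K ∨ jcut K = 0` for every `K`; live line).  N20's face
itself is NOT proved. [cite: Balaban1989LargeFieldII, Thm 1 + (0.1) pp.355–356, (1.80) p.384; King1986, (3.10)–(3.11) p.656 (bookkeeping)] -/
theorem relWeightBound_gap2Carriers_iff_chi (hj : ∀ K, jcut K < K₀ + K ∨ jcut K = 0) (ρ ρ' : ℕ → ℝ) (n₁ n₂ : ℕ → ℕ) (σ σ' : ℕ → ℝ) (m₁ m₂ : ℕ → ℕ) (W : ℕ → ℝ) :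
    RelWeightBound 1 (classSet₁₃Chi θ χ K₀ g₀) (gapWeight2A₁₃Chi θ χ hP K₀ g₀ os ρ ρ' n₁ n₂) (gapWeight2B₁₃Chi θ χ hP K₀ g₀ os ρ ρ' n₁ n₂) (badClass₁₃Chi θ χ K₀ g₀ jcut) W ↔
      RelWeightBound 1 (classSet₁₃Chi θ χ K₀ g₀) (gapWeight2A₁₃Chi θ χ hP K₀ g₀ os σ σ' m₁ m₂) (gapWeight2B₁₃Chi θ χ hP K₀ g₀ os σ σ' m₁ m₂) (badClass₁₃Chi θ χ K₀ g₀ jcut) W := by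
  have hb := fun K t => sum_badClass₁₃Chi_gapWeight2_letter_free θ χ hP K₀ g₀ os jcut E hsel K (hj K) ρ ρ' n₁ n₂ σ σ' m₁ m₂ t
  have hz := fun K t => sum_classSet₁₃Chi_gapWeight2_letter_free θ χ hP K₀ g₀ os E hsel K ρ ρ' n₁ n₂ σ σ' m₁ m₂ t
  constructor
  · intro h
    exact
      { bad_subset := h.bad_subset
        nonneg := h.nonneg
        lt_one := h.lt_one
        summable := h.summable
        bad_left := fun K t ht => by rw [← (hb K t).1, ← (hz K t).1]; exact h.bad_left K t ht
        bad_right := fun K t ht => by rw [← (hb K t).2, ← (hz K t).2]; exact h.bad_right K t ht }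
  · intro h
    exact
      { bad_subset := h.bad_subset
        nonneg := h.nonneg
        lt_one := h.lt_one
        summable := h.summable
        bad_left := fun K t ht => by rw [(hb K t).1, (hz K t).1]; exact h.bad_left K t ht
        bad_right := fun K t ht => by rw [(hb K t).2, (hz K t).2]; exact h.bad_right K t ht }

end LetterFree

/-! ## §3 On the live line: the χ-record's OWN class weights ARE the width-zero doubly-gapped χ-weights; `RelWeightBound` at the pair carriers ⟺ at the record's -/

section RecordR

variable (θ : Stage13HParams F N) (χ : ChiSlot F N) (hP : θ.Provisos₁₃CoPHChi F N χ) (K₀ : ℕ) (g₀ : ℕ → ℝ) (os : List (ULoop F))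
  (E : B12.RunParams → ℝ) (hsel : θ.ppSel = ppSelLiveOfRecord F N θ.ν θ.τ9 E (wOfRecord₉ F N θ.toStage9Params))
include hsel

/-- ★★ **THE χ-RECORD's RUN-A CLASS WEIGHT IS THE WIDTH-ZERO DOUBLY-GAPPED χ-WEIGHT, EVERY KEY, EVERY DEPTH PAIR** (live line): at width `0` both grids read print's letters
`(ε_j, 2δ_{j−1})`, where the pair-lettered term IS the record's post-𝐑 class weight (V6 §55 at the χ-datum). [cite: Balaban1988Convergent, (3.16) p.268; Balaban1989LargeFieldI, (0.3)–(0.4) p.176 (bookkeeping)] -/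
theorem weightA₁₃Chi_eq_gapWeight2A₁₃Chi_widthZero (n₁ n₂ : ℕ → ℕ) (K : ℕ) (t : ℝ) (x : Σ K, SiteSeqKey F (K₀ + K)) :
    weightA₁₃Chi θ χ hP K₀ g₀ os K t x = gapWeight2A₁₃Chi θ χ hP K₀ g₀ os (fun _ => 0) (fun _ => 0) n₁ n₂ K t x := by
  have hζ0 : ∀ p g k s Pl Ql RS U V', 0 ≤ θ.ζ p g k s Pl Ql RS U V' :=
    fun p g k s Pl Ql RS U V' => zetaOfRecord_nonneg F N θ.ν θ.τ9.M hP.zetaUnity hP.zetaAbs p g k s Pl Ql RS U V'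
  have hU : LocalBgMeasurable F N θ.ν := localBgMeasurable F N θ.ν
  have hD : (datumOfRecord₁₃CoPHChi F N θ χ hP).AvgMeasurable := (isPrintedAveraged_datumOfRecord₁₃CoPH_chi F N θ χ hP).avgMeasurable
  unfold weightA₁₃Chi gapWeight2A₁₃Chi
  refine Finset.sum_congr rfl fun s _ => ?_
  simp only [cutGrid_width_zero, bCutGrid_width_zero]
  exact classWeightOfDatum₉_eq_topTerm2AtLevel_eps_twoDelta_of_ppSelLive F N θ.toStage9Params (datumOfRecord₁₃CoPHChi F N θ χ hP) g₀ os (runA₁₃ F K₀ g₀ K)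
    (histA₁₃Chi θ χ K₀ g₀ K) E hsel (histA₁₃Chi_zero θ χ K₀ g₀ K) hD hζ0 hP.zetaMeas hP.zetaAbs t
    (fun k hk s => integrable_chi_mul_dressedSlots_of_ppSelLive θ.toStage9Params E hsel hU hP.zetaMeas hζ0 hP.zetaAbs _ hD g₀ os (histA₁₃Chi_zero θ χ K₀ g₀ K) t k s)
    (K₀ + K) le_rfl s

/-- ★★ **… AND RUN B's.** [cite: Balaban1988Convergent, (3.16) p.268; Balaban1989LargeFieldI, (0.3)–(0.4) p.176 (bookkeeping)] -/
theorem weightB₁₃Chi_eq_gapWeight2B₁₃Chi_widthZero (n₁ n₂ : ℕ → ℕ) (K : ℕ) (t : ℝ) (x : Σ K, SiteSeqKey F (K₀ + K)) :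
    weightB₁₃Chi θ χ hP K₀ g₀ os K t x = gapWeight2B₁₃Chi θ χ hP K₀ g₀ os (fun _ => 0) (fun _ => 0) n₁ n₂ K t x := by
  have hζ0 : ∀ p g k s Pl Ql RS U V', 0 ≤ θ.ζ p g k s Pl Ql RS U V' :=
    fun p g k s Pl Ql RS U V' => zetaOfRecord_nonneg F N θ.ν θ.τ9.M hP.zetaUnity hP.zetaAbs p g k s Pl Ql RS U V'
  have hU : LocalBgMeasurable F N θ.ν := localBgMeasurable F N θ.ν
  have hD : (datumOfRecord₁₃CoPHChi F N θ χ hP).AvgMeasurable := (isPrintedAveraged_datumOfRecord₁₃CoPH_chi F N θ χ hP).avgMeasurable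
  unfold weightB₁₃Chi gapWeight2B₁₃Chi
  refine Finset.sum_congr rfl fun s' _ => ?_
  simp only [cutGrid_width_zero, bCutGrid_width_zero]
  exact classWeightOfDatum₉_eq_topTerm2AtLevel_eps_twoDelta_of_ppSelLive F N θ.toStage9Params (datumOfRecord₁₃CoPHChi F N θ χ hP) g₀ os (runB₁₃ F K₀ g₀ K)
    (histB₁₃Chi θ χ K₀ g₀ K) E hsel (histB₁₃Chi_zero θ χ K₀ g₀ K) hD hζ0 hP.zetaMeas hP.zetaAbs t
    (fun k hk s => integrable_chi_mul_dressedSlots_of_ppSelLive θ.toStage9Params E hsel hU hP.zetaMeas hζ0 hP.zetaAbs _ hD g₀ os (histB₁₃Chi_zero θ χ K₀ g₀ K) t k s)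
    (K₀ + K + 1) le_rfl s'

/-- ★★ **`RelWeightBound` AT THE χ-RECORD's CARRIERS ⟺ AT THE WIDTH-ZERO DOUBLY-GAPPED χ-CARRIERS** (every `W`, every policy, every depth pair; live line).
[cite: Balaban1989LargeFieldII, Thm 1 + (0.1) pp.355–356, (1.80) p.384; King1986, (3.10)–(3.11) p.656 (bookkeeping)] -/
theorem relWeightBound_record_iff_gap2Carriers_widthZero_chi (jcut : ℕ → ℕ) (n₁ n₂ : ℕ → ℕ) (W : ℕ → ℝ) :
    RelWeightBound 1 (classSet₁₃Chi θ χ K₀ g₀) (weightA₁₃Chi θ χ hP K₀ g₀ os) (weightB₁₃Chi θ χ hP K₀ g₀ os) (badClass₁₃Chi θ χ K₀ g₀ jcut) W ↔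
      RelWeightBound 1 (classSet₁₃Chi θ χ K₀ g₀) (gapWeight2A₁₃Chi θ χ hP K₀ g₀ os (fun _ => 0) (fun _ => 0) n₁ n₂)
        (gapWeight2B₁₃Chi θ χ hP K₀ g₀ os (fun _ => 0) (fun _ => 0) n₁ n₂) (badClass₁₃Chi θ χ K₀ g₀ jcut) W := by
  have hA : weightA₁₃Chi θ χ hP K₀ g₀ os = gapWeight2A₁₃Chi θ χ hP K₀ g₀ os (fun _ => 0) (fun _ => 0) n₁ n₂ :=
    funext fun K => funext fun t => funext fun x => weightA₁₃Chi_eq_gapWeight2A₁₃Chi_widthZero θ χ hP K₀ g₀ os E hsel n₁ n₂ K t x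
  have hB : weightB₁₃Chi θ χ hP K₀ g₀ os = gapWeight2B₁₃Chi θ χ hP K₀ g₀ os (fun _ => 0) (fun _ => 0) n₁ n₂ :=
    funext fun K => funext fun t => funext fun x => weightB₁₃Chi_eq_gapWeight2B₁₃Chi_widthZero θ χ hP K₀ g₀ os E hsel n₁ n₂ K t x
  rw [hA, hB]

/-- ★★★ **`RelWeightBound` AT THE DOUBLY-GAPPED χ-CARRIERS ⟺ AT THE χ-RECORD's OWN CARRIERS — THE PAIR ROAD COSTS N20 NOTHING, over the β-slot** (every `W`; policies
`jcut K < K₀ + K ∨ jcut K = 0`; live line).  N20's face itself is NOT proved. [cite: Balaban1989LargeFieldII, Thm 1 + (0.1) pp.355–356, (1.79) p.383, (1.80) p.384, (1.89) p.387; King1986, (3.10)–(3.11) p.656 (bookkeeping)] -/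
theorem relWeightBound_gap2Carriers_iff_record_chi (jcut : ℕ → ℕ) (hj : ∀ K, jcut K < K₀ + K ∨ jcut K = 0) (ρ ρ' : ℕ → ℝ) (n₁ n₂ : ℕ → ℕ) (W : ℕ → ℝ) :
    RelWeightBound 1 (classSet₁₃Chi θ χ K₀ g₀) (gapWeight2A₁₃Chi θ χ hP K₀ g₀ os ρ ρ' n₁ n₂) (gapWeight2B₁₃Chi θ χ hP K₀ g₀ os ρ ρ' n₁ n₂) (badClass₁₃Chi θ χ K₀ g₀ jcut) W ↔
      RelWeightBound 1 (classSet₁₃Chi θ χ K₀ g₀) (weightA₁₃Chi θ χ hP K₀ g₀ os) (weightB₁₃Chi θ χ hP K₀ g₀ os) (badClass₁₃Chi θ χ K₀ g₀ jcut) W :=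
  (relWeightBound_gap2Carriers_iff_chi θ χ hP K₀ g₀ os jcut E hsel hj ρ ρ' n₁ n₂ (fun _ => 0) (fun _ => 0) n₁ n₂ W).trans
    (relWeightBound_record_iff_gap2Carriers_widthZero_chi θ χ hP K₀ g₀ os E hsel jcut n₁ n₂ W).symm

end RecordR

/-! ## §4 At the K3ᴬ v8 mirror (`N = 2`, `χ := chiβOfRecord₁₃Ax θ`, offset `0`): v8's N20 conjunct at ANY below-top cut reading from witnesses at the RE-CENTRED RECORD's OWN carriers -/

section Mirror

variable (jc : CutReading) (ρ ρ' : WidthLetter₁₃CoPHAx 2) (n₁ n₂ : DepthLetter₁₃CoPHAx 2) {cr : SpineReading}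
  (hoff : ∀ (F : T4Family) (θ : Stage13HParams F 2) (hP : θ.Provisos₁₃CoPHAx F 2) (g₀ : ℕ → ℝ) (os : List (ULoop F)),
    ¬ LiveSel F θ → cr F θ hP g₀ os = crOneTerm₁₃Ax 0 F θ hP g₀ os)
include hoff

/-- ★★★ **NODE N20's v8 CONJUNCT ON THE GAP-PINNED SPLIT READING AT ANY BELOW-TOP CUT READING, FROM WITNESSES AT THE RE-CENTRED RECORD's OWN CARRIERS — DIAL-FREE.**
`PinnedAtLiveGap2 jc ρ ρ′ n₁ n₂ cr` (v8's own pin; the cut reading cutting strictly below the top or not at all, `jc … K < K ∨ jc … K = 0`), the off-live pin to `crOneTerm₁₃Ax 0`, and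
on every guarded admissible tuple OF THE LIVE LINE a `RelWeightBound` witness `W` at the record's OWN re-centred carriers `weightA∕B₁₃Ax θ 0 g₀ os hP` with the cut's bad
class `badClass₁₃Ax θ 0 g₀ (jc …)` ⟹ `KeyedRelWeight cr` (§3 at `χ := chiβOfRecord₁₃Ax θ` with `E := EOfRecord₁₃Ax`, then the socket ✓p813406 `keyedRelWeight_of_livePin` ∕
✓p811026 `relWeightBound_crGap2₁₃VAtCmap`).  The witness row is node N20's PRICED face — a HYPOTHESIS asserted for no family; NE7b NOT PRINTED for `d = 4`.
[cite: Balaban1989LargeFieldII, Thm 1 + (0.1) pp.355–356, (1.79) p.383, (1.80) p.384, (1.89) p.387; King1986, (3.10) p.656 (bookkeeping)] -/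
theorem keyedRelWeight_of_liveGap2Pin_of_recordWitness (hon : PinnedAtLiveGap2 jc ρ ρ' n₁ n₂ cr)
    (hjc : ∀ (F : T4Family) (θ : Stage13HParams F 2) (hP : θ.Provisos₁₃CoPHAx F 2) (g₀ : ℕ → ℝ) (os : List (ULoop F)) (K : ℕ),
      jc F θ hP g₀ os K < K ∨ jc F θ hP g₀ os K = 0)
    (hW : ∀ (F : T4Family) (θ : Stage13HParams F 2) (hP : θ.Provisos₁₃CoPHAx F 2), ((θ.ZhUnity F 2 ∧ θ.SlotsNondegenerate₁₃Ax F 2) ∧ LiveSel F θ) → θ.Admissible F 2 →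
      ∀ (g₀ : ℕ → ℝ) (os : List (ULoop F)), ∃ W : ℕ → ℝ,
        RelWeightBound 1 (classSet₁₃Ax θ 0 g₀) (weightA₁₃Ax θ 0 g₀ os hP) (weightB₁₃Ax θ 0 g₀ os hP) (badClass₁₃Ax θ 0 g₀ (jc F θ hP g₀ os)) W) :
    KeyedRelWeight cr :=
  keyedRelWeight_of_livePin (crL := fun F θ hP g₀ os => crGap2₁₃VAx (jc F θ hP g₀ os) ρ ρ' n₁ n₂ F θ hP g₀ os) hon hoff fun F θ hP hG hθ g₀ os => by
    obtain ⟨W, hWt⟩ := hW F θ hP hG hθ g₀ os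
    exact relWeightBound_crGap2₁₃VAtCmap (fun F => chiβOfRecord₁₃Ax F 2) 0 _ ρ ρ' n₁ n₂ θ hP g₀ os
      ((relWeightBound_gap2Carriers_iff_record_chi θ (chiβOfRecord₁₃Ax F 2 θ.toStage13Params) hP 0 g₀ os (EOfRecord₁₃Ax F 2 θ.toStage13Params) hG.2
        (jc F θ hP g₀ os) (fun K => by simpa only [Nat.zero_add] using hjc F θ hP g₀ os K) _ _ _ _ W).2 hWt)

end Mirror

end Summit.QuantumFields.YangMills.BalabanUVNodes.N20InvarianceAtGap2ReadingCmap

end
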